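import Mathlib
import HarnessLib

/-!
# Route `PoloidalWindowDoor`, item `LrcModEntire` (stmt-NavierStokesRegularity-20428), cell (Q4-sonic, straight branch, μ(−1,0) < 0), case I —
# RIGIDITY OF THE SHEET DATA: an `s`-free cross-web component and a bounded along-web component force CONSTANT horizontal velocity on the sheet (brick B-HOL)

Cell ns-regularity-ideate, LEAD-lineage seat ns-poloidal-K2-p3 g17 (`--supports stmt-NavierStokesRegularity-20428`; T2B-g17 v2 §5(5c), s-free branch).  Class-free.

On a sonic web sheet of `e`-parallel lines the two sheet functions `f₁ = U·e∘W`, `f₂ = U·Je∘W` satisfy the Cauchy–Riemann pair of `…Q4SonicSheetCR`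
(`∂_z f₁ = d′·∂_s f₂`, `∂_z f₂ = d′·(c − ∂_s f₁)`, `d′ ≠ 0`).  When the order-3 law makes `f₂` independent of `s` (the branch «A₃ constant» of §5(5c)), the first
identity says `f₁` does not depend on `z`, the second says `∂_s f₁` does not depend on `s`; so `f₁` is affine in `s`, and BOUNDEDNESS of `U` kills the slope:

* `affine_of_hasDerivAt_const` — a function with constant derivative is affine;
* `slope_eq_zero_of_bounded_affine` — a bounded affine function has zero slope;
* `sheetData_const_of_sfree` — **`f₂(s,z) = G(z)`, `∂_z f₁ = 0`, `G′(z) = d′(z)(c(z) − ∂_s f₁(s,z))` on `ℝ × I` (`I` open convex, `d′ ≠ 0`), `f₁(·,z₀)` bounded ⇒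
  `f₁ ≡ f₁(0,z₀)` on `ℝ × I` and `∂_s f₁ ≡ 0` there** — the web-frame strain row `(S_{ee}, S_{eν}) = ∂_s(f₁, f₂)` vanishes: exactly the Cauchy data that
  `…SheetSystemUniqueness` (B-CK2) needs to be zero (T2B-g17 §5(5b)).
* Part 2 (oscillatory branch): `eq_add_of_hasDerivAt_bounded` — `φ′ = q + p′`, `p` and `φ` bounded ⇒ `q = 0` and `φ = φ(0) + p − p(0)`;
  `periodic_of_hasDerivAt_bounded` — if moreover `p` is `L`-periodic, so is `φ`: in the sinusoid case of §5(5c) BOTH sheet functions are `2π/ω₀`-periodic in `s`,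
  so the Cauchy data of the DIFFERENCE system for `U(·+Le) − U` vanish (§5(5e)).

WHAT THIS IS NOT: not a claim about Navier–Stokes regularity and not a stub of the registry; an elementary lemma for the residual research cell `stub_Q4sonicLineNeg`
of `Cruxes/LrcModEntire/Lines/twist_split.lean` v12 (bears_on LADDER-NS N0 via item 20428).
-/

noncomputable section

set_option linter.dupNamespace false

namespace Summit.NavierStokesRegularity.NavierStokesRegularity.Theorems.PoloidalWindowDoorLrcModEntireSheetDataRigidity

open Set Filter Topology

/-- A function on ℝ with constant derivative `q` is affine: `φ s = φ 0 + q·s`. -/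
theorem affine_of_hasDerivAt_const {φ : ℝ → ℝ} {q : ℝ} (h : ∀ s, HasDerivAt φ q s) (s : ℝ) : φ s = φ 0 + q * s := by
  have hd : ∀ x, HasDerivAt (fun x => φ x - q * x) 0 x := by
    intro x
    have h2 : HasDerivAt (fun y => q * y) q x := by simpa using (hasDerivAt_id x).const_mul q
    have h3 := (h x).sub h2
    rwa [sub_self] at h3
  have hdiff : Differentiable ℝ (fun x => φ x - q * x) := fun x => (hd x).differentiableAt
  have hconst := is_const_of_deriv_eq_zero hdiff (fun x => (hd x).deriv) s 0
  simp only [mul_zero, sub_zero] at hconst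
  linarith

/-- A bounded affine function has zero slope. -/
theorem slope_eq_zero_of_bounded_affine {a q M : ℝ} (h : ∀ s : ℝ, |a + q * s| ≤ M) : q = 0 := by
  by_contra hq
  have hM : 0 ≤ M := le_trans (abs_nonneg _) (h 0)
  have h1 := h ((M - a + 1) / q)
  have e : a + q * ((M - a + 1) / q) = M + 1 := by field_simp; ring
  rw [e, abs_of_nonneg (by linarith)] at h1
  linarith

/-- **RIGIDITY OF s-FREE SHEET DATA.**  On `ℝ × I` (`I` open and convex, `z₀ ∈ I`): if `f₁(s,·)` has zero `z`-derivative on `I` for every `s` (first CR identity with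
`f₂` s-free), `f₁(·,z)` has `s`-derivative `e(s,z)` with `G′(z) = d′(z)·(c(z) − e(s,z))` (second CR identity) and `d′ ≠ 0` on `I`, and `f₁(·,z₀)` is bounded, then
`f₁ ≡ f₁(0,z₀)` and `e ≡ 0` on `ℝ × I`. -/
theorem sheetData_const_of_sfree {I : Set ℝ} (hI : IsOpen I) (hIc : Convex ℝ I) {z₀ : ℝ} (hz₀ : z₀ ∈ I)
    {f₁ e : ℝ → ℝ → ℝ} {G' d' c : ℝ → ℝ}
    (hz : ∀ s : ℝ, ∀ z ∈ I, HasDerivAt (fun z' => f₁ s z') 0 z)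
    (hs : ∀ s : ℝ, ∀ z ∈ I, HasDerivAt (fun s' => f₁ s' z) (e s z) s)
    (hCR : ∀ s : ℝ, ∀ z ∈ I, G' z = d' z * (c z - e s z))
    (hd : ∀ z ∈ I, d' z ≠ 0) {M : ℝ} (hbdd : ∀ s : ℝ, |f₁ s z₀| ≤ M) :
    (∀ s : ℝ, ∀ z ∈ I, f₁ s z = f₁ 0 z₀) ∧ (∀ s : ℝ, ∀ z ∈ I, e s z = 0) := by
  -- the `s`-derivative does not depend on `s`
  have he : ∀ s : ℝ, ∀ z ∈ I, e s z = c z - G' z / d' z := by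
    intro s z hzI
    have hdz := hd z hzI
    have h : G' z / d' z = c z - e s z := by
      rw [hCR s z hzI]
      field_simp
    linarith
  -- hence `f₁(·,z)` is affine in `s`
  have haff : ∀ z ∈ I, ∀ s : ℝ, f₁ s z = f₁ 0 z + (c z - G' z / d' z) * s := by
    intro z hzI s
    have hq : ∀ s', HasDerivAt (fun s'' => f₁ s'' z) (c z - G' z / d' z) s' := fun s' => by
      have := hs s' z hzI
      rwa [he s' z hzI] at this
    exact affine_of_hasDerivAt_const hq s
  -- `f₁` does not depend on `z` on the convex open set `I`
  have hzc : ∀ s : ℝ, ∀ z ∈ I, f₁ s z = f₁ s z₀ := by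
    intro s z hzI
    have hdiff : DifferentiableOn ℝ (fun z' => f₁ s z') I := fun z' hz' => (hz s z' hz').differentiableAt.differentiableWithinAt
    have hder : ∀ z' ∈ I, fderivWithin ℝ (fun z' => f₁ s z') I z' = 0 := by
      intro z' hz'
      rw [fderivWithin_of_isOpen hI hz', (hz s z' hz').hasFDerivAt.fderiv]
      ext
      simp
    exact hIc.is_const_of_fderivWithin_eq_zero hdiff hder hzI hz₀
  -- boundedness at `z₀` kills the slope there
  have hslope : c z₀ - G' z₀ / d' z₀ = 0 := by
    refine slope_eq_zero_of_bounded_affine (a := f₁ 0 z₀) (M := M) fun s => ?_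
    rw [← haff z₀ hz₀ s]
    exact hbdd s
  have hconst0 : ∀ s : ℝ, f₁ s z₀ = f₁ 0 z₀ := by
    intro s
    rw [haff z₀ hz₀ s, hslope]
    ring
  refine ⟨fun s z hzI => by rw [hzc s z hzI, hconst0 s], fun s z hzI => ?_⟩
  -- the slope vanishes at every height: compare the affine laws at `z` and `z₀`
  have h1 : ∀ s : ℝ, f₁ 0 z₀ = f₁ 0 z + (c z - G' z / d' z) * s := by
    intro s
    rw [← hconst0 s, ← hzc s z hzI]
    exact haff z hzI s
  have hq0 : c z - G' z / d' z = 0 := by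
    have ha := h1 0
    have hb := h1 1
    simp only [mul_zero, add_zero, mul_one] at ha hb
    linarith
  rw [he s z hzI, hq0]

/-! ### Part 2: the oscillatory branch — a bounded function whose `s`-derivative is «constant + derivative of a bounded function» -/

/-- A bounded function of the form `a + q·s + r(s)` with `r` bounded has `q = 0`. -/
theorem slope_eq_zero_of_bounded_affine_add {a q M R : ℝ} {r : ℝ → ℝ} (hr : ∀ s : ℝ, |r s| ≤ R)
    (h : ∀ s : ℝ, |a + q * s + r s| ≤ M) : q = 0 := by
  refine slope_eq_zero_of_bounded_affine (a := a) (M := M + R) fun s => ?_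
  have h1 := h s
  have h2 := hr s
  have tri : |a + q * s| ≤ |a + q * s + r s| + |r s| := by
    have := abs_sub_abs_le_abs_sub (a + q * s) (-(r s))
    rw [abs_neg, sub_neg_eq_add] at this
    linarith
  linarith

/-- **The oscillatory branch of the sheet data** (T2B-g17 §5(5c), sinusoid case, class-free core): if `φ′ = q + p′` with `p` bounded (in the application `p` is the
primitive of the trigonometric part `−(e′/d′)·(A₃ − c₀)`) and `φ` is bounded, then the secular slope `q` vanishes and `φ = φ(0) + p − p(0)`. -/
theorem eq_add_of_hasDerivAt_bounded {φ p p' : ℝ → ℝ} {q M R : ℝ} (hφ : ∀ s : ℝ, HasDerivAt φ (q + p' s) s)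
    (hp : ∀ s : ℝ, HasDerivAt p (p' s) s) (hpb : ∀ s : ℝ, |p s| ≤ R) (hφb : ∀ s : ℝ, |φ s| ≤ M) :
    q = 0 ∧ ∀ s : ℝ, φ s = φ 0 + (p s - p 0) := by
  -- `φ − p` has constant derivative `q`, hence is affine
  have hd : ∀ s, HasDerivAt (fun x => φ x - p x) q s := by
    intro s
    have := (hφ s).sub (hp s)
    rwa [add_sub_cancel_right] at this
  have haff : ∀ s, φ s - p s = (φ 0 - p 0) + q * s := fun s => affine_of_hasDerivAt_const hd s
  have hq : q = 0 := by
    refine slope_eq_zero_of_bounded_affine_add (a := φ 0 - p 0) (r := p) (R := R) (M := M) hpb fun s => ?_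
    have e : φ 0 - p 0 + q * s + p s = φ s := by linarith [haff s]
    rw [e]; exact hφb s
  refine ⟨hq, fun s => ?_⟩
  have := haff s
  rw [hq, zero_mul, add_zero] at this
  linarith

/-- **Periodicity of the sheet data in the oscillatory branch**: with the hypotheses of `eq_add_of_hasDerivAt_bounded` and `p` periodic of period `L`, `φ` is
periodic of period `L`. -/
theorem periodic_of_hasDerivAt_bounded {φ p p' : ℝ → ℝ} {q M R L : ℝ} (hφ : ∀ s : ℝ, HasDerivAt φ (q + p' s) s)
    (hp : ∀ s : ℝ, HasDerivAt p (p' s) s) (hpb : ∀ s : ℝ, |p s| ≤ R) (hφb : ∀ s : ℝ, |φ s| ≤ M) (hL : ∀ s : ℝ, p (s + L) = p s)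
    (s : ℝ) : φ (s + L) = φ s := by
  obtain ⟨-, hform⟩ := eq_add_of_hasDerivAt_bounded hφ hp hpb hφb
  rw [hform (s + L), hform s, hL s]

end Summit.NavierStokesRegularity.NavierStokesRegularity.Theorems.PoloidalWindowDoorLrcModEntireSheetDataRigidity

end
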